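import Literature.RepresentationTheory.FiniteGroups.SymmetricGroupHookCharacters
import Literature.RepresentationTheory.FiniteGroups.SymmetricGroupCyclePeeling
import Literature.RepresentationTheory.FiniteGroups.SymmetricGroupKroneckerSquareSelfConjugateProofs
import Mathlib.GroupTheory.SpecificGroups.Alternating.Centralizer
import Mathlib.Data.List.Lex
import HarnessLib

/-!
# Murnaghan–Nakayama along principal hooks (James–Kerber 2.4.8, 2.4.9) from Frobenius's formula

Topic `Literature/RepresentationTheory/FiniteGroups`; companion of
`SymmetricGroupKroneckerSquareSelfConjugateProofs.lean`, whose reduction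
`BessenrodtBehns2004_cor_3_2_of_hookValues (H1) (H2)` of Bessenrodt–Behns 2004 Cor. 3.2 asks for two
values of irreducible characters of `S_n` along principal hooks. Everything here is PROVED from the
tree's Frobenius character formula (`spechtCharacter_eq_frobeniusChar`) by peeling the rim of the
first principal hook, generalising the square case of
`Computability/Complexity/OccurrenceObstructionsIPSquareValues.lean`:

* `spechtCharacter_eq_zero_of_firstHook_lt` — **J–K 2.4.9, first step**: `χ^μ(g) = 0` if `g` has a
  cycle longer than the largest hook `h₁₁ = μ₁ + ℓ(μ) - 1`;
* `spechtCharacter_cycle_mul_of_sortedParts_eq_cons` — **J–K 2.4.7 at `k = h₁₁`** (the rim of the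
  first principal hook is the unique rim hook of that length):
  `χ^μ(c τ) = (-1)^{ℓ(μ)-1} χ^{μ∖R₁₁}(τ)` for an `h₁₁`-cycle `c` disjoint from `τ`, where `μ∖R₁₁`
  has parts `μ₂ - 1, μ₃ - 1, …`;
* `exists_hookPartition_of_centralizer_le` — **J–K 2.4.8/2.4.9 for `h⁻¹(q)`** (`H1`): for a split
  class `q` (distinct odd cycle lengths) the partition of nested symmetric hooks of lengths `q` has
  `χ = ±1` on `q` and vanishes on all lexicographically larger cycle types;
* `exists_hookClass_of_transpose_eq` — **J–K 2.4.8 with 2.5.12** (`H2`): for `λ = λᵀ`,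
  `χ^λ(h(λ)) = ε = ±1` with `∏ hᵢᵢ ≡ ε (mod 4)` (`hᵢᵢ = 2(λᵢ - i) + 1`, `ε = (-1)^{Σ(hᵢᵢ-1)/2}`);
* `BessenrodtBehns2004_cor_3_2_holds` — the discharge of the named fact.

Honest framing: classical character theory of `S_n`, vendored for the cell `val-lit` (LADDER-VALIANT V3
bookkeeping); nothing here bears on VP versus VNP.

## References

* G. James, A. Kerber, *The Representation Theory of the Symmetric Group* (1981), 2.4.7 (the
  Murnaghan–Nakayama formula), 2.4.8, 2.4.9, 2.5.12. [JamesKerber1981]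
* C. Bessenrodt, C. Behns, J. Algebra 280 (2004), Cor. 3.2. [BessenrodtBehns2004]
* W. Fulton, J. Harris, *Representation Theory*, GTM 129, Thm. 4.10 (Frobenius's formula),
  Ex. 4.45. [FultonHarrisGTM129]

## Mathlib and tree

Mathlib: `Equiv.Perm.mem_cycleType_iff`, `Equiv.Perm.exists_with_cycleType_iff`,
`Equiv.Perm.centralizer_le_alternating_iff`, `sign_finRotate`, `Finsupp.mapDomain_equiv_apply`,
`Multiset.sort_cons`, `List.Lex`. Tree: `spechtCharacter_eq_frobeniusChar`, `frobeniusChar_def`,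
`fixedWordPoly_cycle_mul`, `coeff_psum_mul`, `coeff_mapDomain_of_rename_eq`,
`rename_alternant_mul_fixedWordPoly`, `frobeniusChar_permCongr`, `cycleType_permCongr`,
`cycleType_subtypePerm_of_disjoint`, `sortedParts_eq_of_parts_eq` pattern, `Nat.Partition.transpose`
(`sortedParts_transpose`). Theorems only; no new definitions.
-/

noncomputable section

open scoped BigOperators
open MvPolynomial Finset

namespace Literature.RepresentationTheory.FiniteGroups

open Literature.RingTheory.SymmetricFunctions.SymmPoly (alternant rho rho_apply)
open Literature.NumberTheory.DiophantineGeometry (spechtCharacter spechtRep)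

variable {n : ℕ}

/-! ### List lemmas: the rim of the first principal hook -/

/-- Zero-padded entries of a weakly decreasing list headed by `a` are at most `a`. [folklore] -/
private theorem getD_le_head_of_pairwise {a : ℕ} {L : List ℕ} (hL : (a :: L).Pairwise (· ≥ ·))
    (i : ℕ) : L.getD i 0 ≤ a := by
  by_cases hi : i < L.length
  · rw [List.getD_eq_getElem _ _ hi]
    exact (List.pairwise_cons.mp hL).1 _ (List.getElem_mem hi)
  · rw [List.getD_eq_default _ _ (not_lt.mp hi)]
    exact Nat.zero_le _

/-- Zero-padded entries of the peeled list `(L.map (· - 1)).filter (0 < ·)` of a weakly decreasing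
list `L`: entry `i` is `L_i - 1`. [folklore] -/
private theorem getD_peel_eq (L : List ℕ) (hL : L.Pairwise (· ≥ ·)) (i : ℕ) :
    ((L.map (· - 1)).filter (fun x => decide (0 < x))).getD i 0 = L.getD i 0 - 1 := by
  induction L generalizing i with
  | nil => simp
  | cons b L ih =>
    have hL' : L.Pairwise (· ≥ ·) := (List.pairwise_cons.mp hL).2
    have hbL : ∀ x ∈ L, x ≤ b := (List.pairwise_cons.mp hL).1
    rw [List.map_cons, List.filter_cons]
    by_cases hb : 0 < b - 1
    · rw [if_pos (by simpa using hb)]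
      cases i with
      | zero => simp
      | succ k => rw [List.getD_cons_succ, List.getD_cons_succ]; exact ih hL' k
    · rw [if_neg (by simpa using hb)]
      -- all entries of `L` are `≤ 1`: the peeled list is empty
      have hzero : (L.map (· - 1)).filter (fun x => decide (0 < x)) = [] := by
        rw [List.filter_eq_nil_iff]
        intro x hx
        obtain ⟨y, hy, rfl⟩ := List.mem_map.mp hx
        have := hbL y hy
        simp only [decide_eq_true_eq, not_lt]
        omega
      rw [hzero, List.getD_nil]
      cases i with
      | zero => simp only [List.getD_cons_zero]; omega
      | succ k =>
        rw [List.getD_cons_succ]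
        have hk := getD_le_head_of_pairwise hL k
        omega

/-- The peeled list is weakly decreasing. [folklore] -/
private theorem pairwise_peel (L : List ℕ) (hL : L.Pairwise (· ≥ ·)) :
    ((L.map (· - 1)).filter (fun x => decide (0 < x))).Pairwise (· ≥ ·) :=
  (hL.map (· - 1) fun a b (h : a ≥ b) => Nat.sub_le_sub_right h 1).sublist List.filter_sublist

/-- Sum of the peeled list: `Σ (L_i - 1) = Σ L_i - ℓ(L)` when all entries are positive. [folklore] -/
private theorem sum_peel_add_length (L : List ℕ) (hpos : ∀ x ∈ L, 0 < x) :
    ((L.map (· - 1)).filter (fun x => decide (0 < x))).sum + L.length = L.sum := by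
  induction L with
  | nil => simp
  | cons b L ih =>
    have hb : 0 < b := hpos b (List.mem_cons_self)
    have ih' := ih (fun x hx => hpos x (List.mem_cons_of_mem _ hx))
    rw [List.map_cons, List.filter_cons]
    by_cases hb1 : 0 < b - 1
    · rw [if_pos (by simpa using hb1), List.sum_cons, List.sum_cons, List.length_cons]
      omega
    · rw [if_neg (by simpa using hb1), List.sum_cons, List.length_cons]
      omega

/-- Entries of the peeled list are positive. [folklore] -/
private theorem pos_of_mem_peel (L : List ℕ) {x : ℕ}
    (hx : x ∈ (L.map (· - 1)).filter (fun x => decide (0 < x))) : 0 < x := by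
  have := (List.mem_filter.mp hx).2
  simpa using this

/-! ### The partition `μ ∖ R₁₁` (first row and first column removed) -/

/-- **Removing the rim of the first principal hook.** If `μ ⊢ n` has sorted parts `a :: L`, there
is a partition `μ' ⊢ n - (a + ℓ(L))` with sorted parts `(L_i - 1)_i` (zeros dropped): the diagram of
`μ` with its first row and first column removed (James–Kerber 2.4.7: `[α] ∖ R₁₁^α`; the rim of the
hook `H₁₁` consists of the last box of each column and row it meets, and removing it shifts rows
`2, 3, …` by one). [cite: JamesKerber1981, 2.4.7] -/
theorem exists_rimPeel (μ : Nat.Partition n) {a : ℕ} {L : List ℕ} (hs : μ.sortedParts = a :: L) :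
    a + L.length ≤ n ∧
    ∃ μ' : Nat.Partition (n - (a + L.length)),
      μ'.sortedParts = (L.map (· - 1)).filter (fun x => decide (0 < x)) := by
  have hsum : a + L.sum = n := by
    have h := μ.sum_sortedParts; rw [hs, List.sum_cons] at h; exact h
  have hpos : ∀ x ∈ L, 0 < x := fun x hx =>
    μ.pos_of_mem_sortedParts (by rw [hs]; exact List.mem_cons_of_mem _ hx)
  have hsort : (a :: L).Pairwise (· ≥ ·) := by
    have h := (μ.sortedGE_sortedParts).pairwise; rw [hs] at h; exact h
  have hlen : L.length ≤ L.sum := by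
    have := List.length_le_sum_of_one_le L (fun x hx => hpos x hx); exact this
  have hle : a + L.length ≤ n := by omega
  refine ⟨hle, ?_⟩
  have hMsum : ((L.map (· - 1)).filter (fun x => decide (0 < x))).sum = n - (a + L.length) := by
    have h := sum_peel_add_length L hpos
    omega
  refine ⟨⟨((L.map (· - 1)).filter (fun x => decide (0 < x)) : Multiset ℕ),
    fun {x} hx => pos_of_mem_peel L (Multiset.mem_coe.mp hx), by rw [Multiset.sum_coe, hMsum]⟩, ?_⟩
  change Multiset.sort _ (· ≥ ·) = _
  rw [Multiset.coe_sort]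
  exact List.mergeSort_eq_self _ (pairwise_peel L (List.pairwise_cons.mp hsort).2)

/-! ### Frobenius's formula along the first principal hook -/

/-- The exponent vector `μ + ρ` of Frobenius's formula in `N = ℓ(L) + 1` variables for sorted parts
`a :: L`: entry `0` is the first hook length `a + ℓ(L)`, all other entries are smaller. [folklore] -/
private theorem add_rho_apply_cons {a : ℕ} {L : List ℕ} (hL : (a :: L).Pairwise (· ≥ ·))
    (i : Fin (L.length + 1)) :
    ((fun i : Fin (L.length + 1) => (a :: L).getD i 0) + rho (L.length + 1)) i =
      (a :: L).getD i 0 + (L.length - i) ∧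
    ((a :: L).getD i 0 + (L.length - i) = a + L.length ↔ (i : ℕ) = 0) ∧
    (a :: L).getD i 0 + (L.length - i) ≤ a + L.length := by
  have hi := i.2
  refine ⟨by rw [Pi.add_apply, rho_apply]; congr 1; omega, ?_, ?_⟩
  · constructor
    · intro h
      by_contra h0
      obtain ⟨k, hk⟩ : ∃ k, (i : ℕ) = k + 1 := ⟨(i : ℕ) - 1, by omega⟩
      rw [hk, List.getD_cons_succ] at h
      have := getD_le_head_of_pairwise hL k
      omega
    · intro h
      rw [h, List.getD_cons_zero]
      omega
  · rcases Nat.eq_zero_or_pos (i : ℕ) with h0 | hpos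
    · rw [h0, List.getD_cons_zero]; omega
    · obtain ⟨k, hk⟩ : ∃ k, (i : ℕ) = k + 1 := ⟨(i : ℕ) - 1, by omega⟩
      rw [hk, List.getD_cons_succ]
      have := getD_le_head_of_pairwise hL k
      omega

/-- **James–Kerber 2.4.9, first step: no hook is longer than `h₁₁`.** If `μ ⊢ n` has sorted parts
`a :: L` and `g` has a cycle of length `> a + ℓ(L) = h₁₁(μ)`, then `χ^μ(g) = 0`: by Frobenius's
formula in `ℓ(μ)` variables, `χ^μ(g) = [x^α](p_m G)` with `α₀ = h₁₁ < m`.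
[cite: JamesKerber1981, 2.4.9] -/
theorem spechtCharacter_eq_zero_of_firstHook_lt (μ : Nat.Partition n) {a : ℕ} {L : List ℕ}
    (hs : μ.sortedParts = a :: L) (g : Equiv.Perm (Fin n))
    (hm : ∃ m ∈ g.cycleType, a + L.length < m) : spechtCharacter ℂ μ g = 0 := by
  classical
  obtain ⟨m, hmem, hlt⟩ := hm
  obtain ⟨c, τ, rfl, hd, hc, hcard⟩ := Equiv.Perm.mem_cycleType_iff.1 hmem
  have hsort : (a :: L).Pairwise (· ≥ ·) := by
    have h := (μ.sortedGE_sortedParts).pairwise; rw [hs] at h; exact h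
  have hN : μ.parts.card ≤ L.length + 1 := by
    rw [← Nat.Partition.length_sortedParts, hs, List.length_cons]
  rw [spechtCharacter_eq_frobeniusChar (N := L.length + 1) μ hN, frobeniusChar_def,
    fixedWordPoly_cycle_mul hd hc, hcard, mul_left_comm, coeff_psum_mul,
    Finset.filter_eq_empty_iff.2, Finset.sum_empty, Int.cast_zero]
  intro i _
  rw [Finsupp.coe_equivFunOnFinite_symm, hs, (add_rho_apply_cons hsort i).1]
  have := (add_rho_apply_cons hsort i).2.2
  omega

/-- **James–Kerber 2.4.7 at `k = h₁₁` (peeling the first principal hook).** If `μ ⊢ n` has sorted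
parts `a :: L`, `μ' = μ ∖ R₁₁ ⊢ n - h₁₁` (`h₁₁ = a + ℓ(L)`; sorted parts `(L_i - 1)_i`), and
`g = c τ` with `c` an `h₁₁`-cycle disjoint from `τ`, then `χ^μ(c τ) = (-1)^{ℓ(L)} χ^{μ'}(τ|_B)`
(`B` the complement of the support of `c`, transported to `Fin (n - h₁₁)`): the rim of `H₁₁` is the
unique rim hook of length `h₁₁`, of leg length `ℓ(μ) - 1 = ℓ(L)`. Proof: in Frobenius's formula
with `N = ℓ(L) + 1` variables, `[x^α](p_{h₁₁} G) = [x^{α - h₁₁ e₀}] G`, and `α - h₁₁ e₀ =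
(0, α₁, …)` is the rotation of `μ' + ρ`. [cite: JamesKerber1981, 2.4.7] -/
theorem spechtCharacter_cycle_mul_of_sortedParts_eq_cons (μ : Nat.Partition n) {a : ℕ}
    {L : List ℕ} (hs : μ.sortedParts = a :: L) {n' : ℕ} (μ' : Nat.Partition n')
    (hs' : μ'.sortedParts = (L.map (· - 1)).filter (fun x => decide (0 < x)))
    {c τ : Equiv.Perm (Fin n)} (hd : c.Disjoint τ) (hc : c.IsCycle)
    (hcard : c.support.card = a + L.length)
    (eB : ↥(c.supportᶜ) ≃ Fin n') :
    spechtCharacter ℂ μ (c * τ) = (-1) ^ L.length *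
      spechtCharacter ℂ μ' (eB.permCongr (τ.subtypePerm (p := fun x => x ∈ c.supportᶜ)
        (fun x => mem_compl_support_iff_of_disjoint hd x))) := by
  classical
  have hsort : (a :: L).Pairwise (· ≥ ·) := by
    have h := (μ.sortedGE_sortedParts).pairwise; rw [hs] at h; exact h
  have hposL : ∀ x ∈ L, 0 < x := fun x hx =>
    μ.pos_of_mem_sortedParts (by rw [hs]; exact List.mem_cons_of_mem _ hx)
  set τB := τ.subtypePerm (p := fun x => x ∈ c.supportᶜ)
    (fun x => mem_compl_support_iff_of_disjoint hd x) with hτB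
  -- exponent vectors (`N = ℓ(L) + 1` variables)
  set lamV : Fin (L.length + 1) → ℕ := fun i => μ.sortedParts.getD i 0 with hlamV
  set μV : Fin (L.length + 1) → ℕ := fun i => μ'.sortedParts.getD i 0 with hμV
  set α : Fin (L.length + 1) →₀ ℕ := Finsupp.equivFunOnFinite.symm (lamV + rho (L.length + 1))
    with hα
  set γ : Fin (L.length + 1) →₀ ℕ := Finsupp.equivFunOnFinite.symm (μV + rho (L.length + 1))
    with hγ
  have hαapply : ∀ i : Fin (L.length + 1), α i = (a :: L).getD i 0 + (L.length - i) := fun i => by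
    rw [hα, Finsupp.coe_equivFunOnFinite_symm, hlamV]
    simp only [hs]
    exact (add_rho_apply_cons hsort i).1
  have hγapply : ∀ i : Fin (L.length + 1), γ i = (L.getD i 0 - 1) + (L.length - i) := fun i => by
    rw [hγ, Finsupp.coe_equivFunOnFinite_symm, hμV, Pi.add_apply, rho_apply, hs', getD_peel_eq L
      (List.pairwise_cons.mp hsort).2]
    have := i.2
    congr 1
    omega
  have hrot : α - Finsupp.single 0 (a + L.length) = Finsupp.mapDomain (finRotate (L.length + 1)) γ := by
    ext j
    rw [Finsupp.mapDomain_equiv_apply]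
    obtain ⟨i, rfl⟩ := (finRotate (L.length + 1)).surjective j
    rw [Equiv.symm_apply_apply, Finsupp.coe_tsub, Pi.sub_apply, hαapply, hγapply,
      Finsupp.single_apply]
    have hi := i.2
    by_cases hlast : i = Fin.last L.length
    · subst hlast
      rw [finRotate_last, if_pos rfl, Fin.val_zero, List.getD_cons_zero, Fin.val_last,
        List.getD_eq_default _ _ le_rfl]
      omega
    · have hval : ((finRotate (L.length + 1)) i : ℕ) = i + 1 := by
        rw [finRotate_apply, Fin.val_add_one, if_neg hlast]
      have hne0 : ¬ ((0 : Fin (L.length + 1)) = (finRotate (L.length + 1)) i) := by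
        intro h0; rw [Fin.ext_iff, hval, Fin.val_zero] at h0; omega
      rw [if_neg hne0, hval, List.getD_cons_succ]
      have hlt : (i : ℕ) < L.length := by
        rw [Fin.ext_iff, Fin.val_last] at hlast; omega
      have hpos : 0 < L.getD i 0 := by
        rw [List.getD_eq_getElem _ _ hlt]; exact hposL _ (List.getElem_mem hlt)
      omega
  -- the integer identity
  have key : frobeniusChar (L.length + 1) lamV (c * τ) =
      (Equiv.Perm.sign (finRotate (L.length + 1)) : ℤ) * frobeniusChar (L.length + 1) μV τB := by
    rw [frobeniusChar_def, fixedWordPoly_cycle_mul hd hc, hcard, mul_left_comm, coeff_psum_mul, ← hα]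
    have hfilter : (univ.filter fun i : Fin (L.length + 1) => a + L.length ≤ α i) = {0} := by
      ext i
      simp only [mem_filter, mem_univ, true_and, Finset.mem_singleton, hαapply]
      have h2 := (add_rho_apply_cons hsort i).2
      rw [Fin.ext_iff, Fin.val_zero]
      constructor
      · intro h; exact h2.1.mp (le_antisymm h2.2 h)
      · intro h; rw [h2.1.mpr h]
    rw [hfilter, Finset.sum_singleton, hrot,
      coeff_mapDomain_of_rename_eq (rename_alternant_mul_fixedWordPoly _ _ _), frobeniusChar_def]
  -- back to characters
  have hN1 : μ.parts.card ≤ L.length + 1 := by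
    rw [← Nat.Partition.length_sortedParts, hs, List.length_cons]
  have hN2 : μ'.parts.card ≤ L.length + 1 := by
    rw [← Nat.Partition.length_sortedParts, hs']
    calc ((L.map (· - 1)).filter (fun x => decide (0 < x))).length ≤ (L.map (· - 1)).length :=
          List.length_filter_le _ _
      _ = L.length := List.length_map _
      _ ≤ L.length + 1 := Nat.le_succ _
  rw [spechtCharacter_eq_frobeniusChar (N := L.length + 1) _ hN1, key,
    ← frobeniusChar_permCongr μV eB τB, Int.cast_mul,
    ← spechtCharacter_eq_frobeniusChar (N := L.length + 1) _ hN2, sign_finRotate,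
    Units.val_pow_eq_pow_val, Units.val_neg, Units.val_one, Int.cast_pow, Int.cast_neg, Int.cast_one,
    Nat.add_sub_cancel]

/-! ### Cycle types as sorted lists -/

/-- The sorted cycle type of `c τ` (an `a`-cycle `c` disjoint from `τ`, `a` at least every cycle
length of `τ`) is `a ::` the sorted cycle type of `τ`. [folklore] -/
private theorem sort_cycleType_cycle_mul {c τ : Equiv.Perm (Fin n)} (hd : c.Disjoint τ)
    (hc : c.IsCycle) {a : ℕ} (hcard : c.support.card = a) (ha : ∀ m ∈ τ.cycleType, m ≤ a) :
    (c * τ).cycleType.sort (· ≥ ·) = a :: τ.cycleType.sort (· ≥ ·) := by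
  rw [hd.cycleType_mul, hc.cycleType, hcard, Multiset.singleton_add, Multiset.sort_cons]
  exact fun b hb => ha b hb

/-- Every element of a multiset is at most the head of its decreasingly sorted list. [folklore] -/
private theorem le_of_sort_eq_cons {s : Multiset ℕ} {a : ℕ} {l : List ℕ}
    (h : s.sort (· ≥ ·) = a :: l) {m : ℕ} (hm : m ∈ s) : m ≤ a := by
  have hsorted := Multiset.pairwise_sort (s := s) (r := (· ≥ ·))
  rw [h, List.pairwise_cons] at hsorted
  have hm' : m ∈ a :: l := by rw [← h]; exact (Multiset.mem_sort (r := (· ≥ ·))).mpr hm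
  rcases List.mem_cons.mp hm' with rfl | hml
  · exact le_rfl
  · exact hsorted.1 m hml

/-- The head of the decreasingly sorted list of a multiset belongs to it. [folklore] -/
private theorem mem_of_sort_eq_cons {s : Multiset ℕ} {a : ℕ} {l : List ℕ}
    (h : s.sort (· ≥ ·) = a :: l) : a ∈ s := by
  rw [← Multiset.mem_sort (r := (· ≥ ·)), h]; exact List.mem_cons_self

/-! ### James–Kerber 2.4.8/2.4.9 for the partitions of nested symmetric hooks (`H1`) -/

/-- **The hook-adapted partition of a split type** (James–Kerber 2.5.11: `h : SA(n) → SP(n)` is a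
bijection; 2.4.8: `ζ^α_{h(α)} = ±1`; 2.4.9: `ζ^α_β ≠ 0 ⇒ β ≤ h(α)`). For a strictly decreasing list
`q` of odd numbers `≥ 3` with gaps `≥ 2` and `n ∈ {Σ q, Σ q + 1}`, the partition `γ ⊢ n` of nested
symmetric hooks of lengths `q` (plus a centre box if `n = Σ q + 1`) satisfies `χ^γ(g₀) = ±1` for
`g₀` of cycle type `q` and `χ^γ(g) = 0` whenever the sorted cycle type of `g` is lexicographically
larger than `q`. (Proof by peeling the first hook: `spechtCharacter_cycle_mul_of_sortedParts_eq_cons`,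
`spechtCharacter_eq_zero_of_firstHook_lt`.) [cite: JamesKerber1981, 2.4.8 and 2.4.9] -/
theorem exists_hookPartition (q : List ℕ) (hq : q.Pairwise (fun x y => y + 2 ≤ x))
    (hodd : ∀ x ∈ q, Odd x) (h3 : ∀ x ∈ q, 3 ≤ x) :
    ∀ n : ℕ, (n = q.sum ∨ n = q.sum + 1) →
      ∃ γ : Nat.Partition n,
        (∀ p ∈ γ.parts, p ≤ (q.headD 1 + 1) / 2) ∧ γ.parts.card ≤ (q.headD 1 + 1) / 2 ∧
        (∀ g₀ : Equiv.Perm (Fin n), g₀.cycleType.sort (· ≥ ·) = q →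
          (spechtCharacter ℂ γ g₀ = 1 ∨ spechtCharacter ℂ γ g₀ = -1)) ∧
        (∀ g : Equiv.Perm (Fin n), List.Lex (· < ·) q (g.cycleType.sort (· ≥ ·)) →
          spechtCharacter ℂ γ g = 0) := by
  classical
  induction q with
  | nil =>
    intro n hn
    simp only [List.sum_nil, zero_add] at hn
    have hn1 : n ≤ 1 := by omega
    haveI : Subsingleton (Fin n) := by
      rcases hn with rfl | rfl <;> infer_instance
    refine ⟨Nat.Partition.indiscrete n, ?_, ?_, ?_, ?_⟩
    · intro p hp
      rcases hn with rfl | rfl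
      · simp [Nat.Partition.indiscrete] at hp
      · rw [Nat.Partition.indiscrete_parts one_ne_zero, Multiset.mem_singleton] at hp
        simp [hp]
    · rcases hn with rfl | rfl
      · simp [Nat.Partition.indiscrete]
      · rw [Nat.Partition.indiscrete_parts one_ne_zero, Multiset.card_singleton]
        simp
    · intro g₀ _
      left
      refine spechtCharacter_eq_one_of_card_parts_le_one _ ?_ g₀
      rcases hn with rfl | rfl
      · simp [Nat.Partition.indiscrete]
      · rw [Nat.Partition.indiscrete_parts one_ne_zero, Multiset.card_singleton]
    · intro g hlex
      have hg : g = 1 := Subsingleton.elim _ _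
      rw [hg, Equiv.Perm.cycleType_one, Multiset.sort_zero] at hlex
      cases hlex
  | cons a q ih =>
    intro n hn
    -- data of the step
    obtain ⟨ha_odd, -⟩ : Odd a ∧ True := ⟨hodd a List.mem_cons_self, trivial⟩
    have ha3 : 3 ≤ a := h3 a List.mem_cons_self
    have hq' : q.Pairwise (fun x y => y + 2 ≤ x) := (List.pairwise_cons.mp hq).2
    have haq : ∀ y ∈ q, y + 2 ≤ a := (List.pairwise_cons.mp hq).1
    obtain ⟨b, hb⟩ : ∃ b, a = 2 * b - 1 ∧ 2 ≤ b := by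
      obtain ⟨k, hk⟩ := ha_odd; exact ⟨k + 1, by omega, by omega⟩
    obtain ⟨hab, hb2⟩ := hb
    have hB' : (q.headD 1 + 1) / 2 ≤ b - 1 := by
      cases q with
      | nil => simp; omega
      | cons y q'' =>
        have := haq y List.mem_cons_self
        have hy := hodd y (List.mem_cons_of_mem _ List.mem_cons_self)
        obtain ⟨k, hk⟩ := hy
        simp only [List.headD_cons]
        omega
    have hn' : n - a = q.sum ∨ n - a = q.sum + 1 := by
      simp only [List.sum_cons] at hn; omega
    have hna : a ≤ n := by simp only [List.sum_cons] at hn; omega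
    obtain ⟨γ', hγ'le, hγ'card, hγ'val, hγ'van⟩ :=
      ih hq' (fun x hx => hodd x (List.mem_cons_of_mem _ hx))
        (fun x hx => h3 x (List.mem_cons_of_mem _ hx)) (n - a) hn'
    -- the wrapped partition `γ = (b, γ'₁ + 1, γ'₂ + 1, …, 1, …, 1)` with `b` parts
    set M : List ℕ := γ'.sortedParts.map (· + 1) ++ List.replicate (b - 1 - γ'.parts.card) 1
      with hMdef
    have hγ'pos : ∀ x ∈ γ'.sortedParts, 0 < x := fun x hx => γ'.pos_of_mem_sortedParts hx
    have hγ'leb : ∀ x ∈ γ'.sortedParts, x + 1 ≤ b := fun x hx => by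
      have := hγ'le x ((Multiset.mem_sort _).mp hx); omega
    have hMlen : M.length = b - 1 := by
      rw [hMdef, List.length_append, List.length_map, List.length_replicate,
        Nat.Partition.length_sortedParts]
      omega
    have hMle : ∀ x ∈ M, x ≤ b := by
      intro x hx
      rcases List.mem_append.mp hx with hx | hx
      · obtain ⟨y, hy, rfl⟩ := List.mem_map.mp hx; exact hγ'leb y hy
      · rw [List.eq_of_mem_replicate hx]; omega
    have hMpos : ∀ x ∈ M, 0 < x := by
      intro x hx
      rcases List.mem_append.mp hx with hx | hx
      · obtain ⟨y, hy, rfl⟩ := List.mem_map.mp hx; omega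
      · rw [List.eq_of_mem_replicate hx]; omega
    have hMsorted : (b :: M).Pairwise (· ≥ ·) := by
      rw [List.pairwise_cons]
      refine ⟨fun x hx => hMle x hx, ?_⟩
      rw [hMdef, List.pairwise_append]
      refine ⟨(γ'.sortedGE_sortedParts.pairwise).map _ fun x y (h : x ≥ y) => by
          show x + 1 ≥ y + 1; omega, List.pairwise_replicate.mpr (Or.inr le_rfl), ?_⟩
      intro x hx y hy
      obtain ⟨z, hz, rfl⟩ := List.mem_map.mp hx
      rw [List.eq_of_mem_replicate hy]
      show z + 1 ≥ 1
      omega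
    have hMsum : b + M.sum = n := by
      rw [hMdef, List.sum_append, List.sum_replicate, smul_eq_mul, mul_one, List.sum_map_add,
        List.map_id', List.map_const', List.sum_replicate, smul_eq_mul, mul_one,
        Nat.Partition.sum_sortedParts, Nat.Partition.length_sortedParts]
      omega
    have hpeelM : (M.map (· - 1)).filter (fun x => decide (0 < x)) = γ'.sortedParts := by
      rw [hMdef, List.map_append, List.map_map, List.map_replicate, List.filter_append]
      have h1 : ((fun x => x - 1) ∘ fun x => x + 1) = id := by funext x; simp
      rw [h1, List.map_id, List.filter_eq_self.mpr (fun x hx => by simpa using hγ'pos x hx),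
        List.filter_eq_nil_iff.mpr (fun x hx => by rw [List.eq_of_mem_replicate hx]; simp),
        List.append_nil]
    let γ : Nat.Partition n := ⟨((b :: M : List ℕ) : Multiset ℕ), fun {x} hx => by
        rcases List.mem_cons.mp (Multiset.mem_coe.mp hx) with rfl | hx
        · omega
        · exact hMpos x hx, by rw [Multiset.sum_coe, List.sum_cons, hMsum]⟩
    have hγs : γ.sortedParts = b :: M := by
      change Multiset.sort _ (· ≥ ·) = _
      rw [Multiset.coe_sort]
      exact List.mergeSort_eq_self _ hMsorted
    have hfirst : b + M.length = a := by rw [hMlen]; omega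
    refine ⟨γ, ?_, ?_, ?_, ?_⟩
    · -- parts bounded by `b = (a + 1) / 2`
      intro p hp
      have hp' : p ∈ b :: M := Multiset.mem_coe.mp hp
      simp only [List.headD_cons]
      rcases List.mem_cons.mp hp' with rfl | hp'
      · omega
      · have := hMle p hp'; omega
    · simp only [List.headD_cons]
      show (((b :: M : List ℕ) : Multiset ℕ)).card ≤ (a + 1) / 2
      rw [Multiset.coe_card, List.length_cons, hMlen]
      omega
    · -- `χ^γ = ±1` on the class `a :: q`
      intro g₀ hg₀
      have hamem : a ∈ g₀.cycleType := mem_of_sort_eq_cons hg₀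
      obtain ⟨c, τ, rfl, hd, hc, hcard⟩ := Equiv.Perm.mem_cycleType_iff.1 hamem
      have hcardB : Fintype.card ↥(c.supportᶜ) = Fintype.card (Fin (n - a)) := by
        rw [Fintype.card_coe, Finset.card_compl, hcard, Fintype.card_fin, Fintype.card_fin]
      set eB : ↥(c.supportᶜ) ≃ Fin (n - a) := Fintype.equivOfCardEq hcardB
      have hτle : ∀ m ∈ τ.cycleType, m ≤ a := fun m hm =>
        le_of_sort_eq_cons hg₀ (by rw [hd.cycleType_mul]; exact Multiset.mem_add.mpr (Or.inr hm))
      have hsortτ : τ.cycleType.sort (· ≥ ·) = q := by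
        have h := sort_cycleType_cycle_mul hd hc hcard hτle
        rw [hg₀] at h
        exact (List.cons_injective h).symm
      rw [spechtCharacter_cycle_mul_of_sortedParts_eq_cons γ hγs γ' hpeelM.symm hd hc
        (hcard.trans hfirst.symm) eB]
      have hval := hγ'val (eB.permCongr _) (by
        rw [cycleType_permCongr, cycleType_subtypePerm_of_disjoint hd, hsortτ])
      rcases neg_one_pow_eq_or ℂ M.length with h | h <;> rcases hval with h' | h' <;>
        simp [h, h']
    · -- vanishing above `a :: q`
      intro g hlex
      obtain ⟨m, rest, hm⟩ : ∃ m rest, g.cycleType.sort (· ≥ ·) = m :: rest := by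
        cases hsort : g.cycleType.sort (· ≥ ·) with
        | nil => rw [hsort] at hlex; cases hlex
        | cons m rest => exact ⟨m, rest, rfl⟩
      rw [hm] at hlex
      have hmmem : m ∈ g.cycleType := mem_of_sort_eq_cons hm
      cases hlex with
      | rel h =>
        -- a cycle longer than the first hook
        exact spechtCharacter_eq_zero_of_firstHook_lt γ hγs g ⟨m, hmmem, by rw [hfirst]; exact h⟩
      | cons h =>
        -- `m = a`: peel the first hook and use the induction hypothesis
        obtain ⟨c, τ, rfl, hd, hc, hcard⟩ := Equiv.Perm.mem_cycleType_iff.1 hmmem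
        have hcardB : Fintype.card ↥(c.supportᶜ) = Fintype.card (Fin (n - a)) := by
          rw [Fintype.card_coe, Finset.card_compl, hcard, Fintype.card_fin, Fintype.card_fin]
        set eB : ↥(c.supportᶜ) ≃ Fin (n - a) := Fintype.equivOfCardEq hcardB
        have hτle : ∀ m' ∈ τ.cycleType, m' ≤ a := fun m' hm' =>
          le_of_sort_eq_cons hm (by rw [hd.cycleType_mul]; exact Multiset.mem_add.mpr (Or.inr hm'))
        have hsortτ : τ.cycleType.sort (· ≥ ·) = rest := by
          have h' := sort_cycleType_cycle_mul hd hc hcard hτle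
          rw [hm] at h'
          exact (List.cons_injective h').symm
        rw [spechtCharacter_cycle_mul_of_sortedParts_eq_cons γ hγs γ' hpeelM.symm hd hc
          (hcard.trans hfirst.symm) eB, hγ'van (eB.permCongr _) (by
            rw [cycleType_permCongr, cycleType_subtypePerm_of_disjoint hd, hsortτ]; exact h),
          mul_zero]

/-- **`H1`: James–Kerber 2.4.8/2.4.9 for the split classes of `S_n`.** For `g₀` with centralizer in
`A_n` (cycle lengths distinct and odd, at most one fixed point) there is `γ ⊢ n` (nested symmetric
hooks of the cycle lengths of `g₀`, i.e. `h(γ) =` type of `g₀`) with `χ^γ(g₀) = ±1` and `χ^γ = 0`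
on every lexicographically larger cycle type. [cite: JamesKerber1981, 2.4.8 and 2.4.9] -/
theorem exists_hookPartition_of_centralizer_le (g₀ : Equiv.Perm (Fin n))
    (hsplit : Subgroup.centralizer {g₀} ≤ alternatingGroup (Fin n)) :
    ∃ γ : Nat.Partition n, (spechtCharacter ℂ γ g₀ = 1 ∨ spechtCharacter ℂ γ g₀ = -1) ∧
      ∀ g : Equiv.Perm (Fin n),
        List.Lex (· < ·) (g₀.cycleType.sort (· ≥ ·)) (g.cycleType.sort (· ≥ ·)) →
          spechtCharacter ℂ γ g = 0 := by
  classical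
  rw [Equiv.Perm.centralizer_le_alternating_iff, Fintype.card_fin] at hsplit
  obtain ⟨hodd, hcard, hcount⟩ := hsplit
  have hmem : ∀ x, x ∈ g₀.cycleType.sort (· ≥ ·) ↔ x ∈ g₀.cycleType := fun x =>
    Multiset.mem_sort (r := (· ≥ ·))
  have hnodup : (g₀.cycleType.sort (· ≥ ·)).Nodup := by
    rw [← Multiset.coe_nodup, Multiset.sort_eq]
    exact Multiset.nodup_iff_count_le_one.mpr hcount
  have hpair : (g₀.cycleType.sort (· ≥ ·)).Pairwise (fun x y => y + 2 ≤ x) := by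
    have h1 : (g₀.cycleType.sort (· ≥ ·)).Pairwise (· ≥ ·) := Multiset.pairwise_sort _ _
    have h2 : (g₀.cycleType.sort (· ≥ ·)).Pairwise (· ≠ ·) := hnodup
    refine (h1.and h2).imp_of_mem ?_
    intro x y hx hy hxy
    obtain ⟨hge, hne⟩ := hxy
    obtain ⟨k, hk⟩ := hodd x ((hmem x).mp hx)
    obtain ⟨l, hl⟩ := hodd y ((hmem y).mp hy)
    omega
  have hodd' : ∀ x ∈ g₀.cycleType.sort (· ≥ ·), Odd x := fun x hx => hodd x ((hmem x).mp hx)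
  have h3 : ∀ x ∈ g₀.cycleType.sort (· ≥ ·), 3 ≤ x := fun x hx => by
    have h2 := Equiv.Perm.two_le_of_mem_cycleType ((hmem x).mp hx)
    obtain ⟨k, hk⟩ := hodd x ((hmem x).mp hx)
    omega
  have hsum : (g₀.cycleType.sort (· ≥ ·)).sum = g₀.cycleType.sum := by
    rw [← Multiset.sum_coe, Multiset.sort_eq]
  have hn : n = (g₀.cycleType.sort (· ≥ ·)).sum ∨ n = (g₀.cycleType.sort (· ≥ ·)).sum + 1 := by
    have := g₀.sum_cycleType_le
    rw [Fintype.card_fin] at this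
    omega
  obtain ⟨γ, -, -, hval, hvan⟩ := exists_hookPartition _ hpair hodd' h3 n hn
  exact ⟨γ, hval g₀ rfl, hvan⟩

/-! ### James–Kerber 2.4.8 with 2.5.12 for self-associated `λ` (`H2`) -/

/-- Initial segments of a weakly decreasing list: `j < L_i` iff `i` is below the number of entries
`> j`. [folklore] -/
private theorem lt_getElem_iff_lt_length_filter {L : List ℕ} (hL : L.Pairwise (· ≥ ·)) (j i : ℕ) :
    (∃ h : i < L.length, j < L[i]) ↔ i < (L.filter (fun p => decide (j < p))).length := by
  induction L generalizing i with
  | nil => simp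
  | cons b L ih =>
    have hL' := (List.pairwise_cons.mp hL).2
    have hbL := (List.pairwise_cons.mp hL).1
    rw [List.filter_cons]
    by_cases hjb : j < b
    · rw [if_pos (by simpa using hjb)]
      cases i with
      | zero => simpa using hjb
      | succ k =>
        have e1 : (∃ h : k + 1 < (b :: L).length, j < (b :: L)[k + 1]) ↔
            ∃ h : k < L.length, j < L[k] := by
          constructor
          · rintro ⟨h, hj⟩; exact ⟨by simpa using h, by simpa using hj⟩
          · rintro ⟨h, hj⟩; exact ⟨by simpa using h, by simpa using hj⟩
        rw [e1, ih hL' k, List.length_cons]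
        omega
    · rw [if_neg (by simpa using hjb)]
      have hnil : L.filter (fun p => decide (j < p)) = [] := List.filter_eq_nil_iff.mpr fun x hx => by
        have := hbL x hx
        simp only [decide_eq_true_eq, not_lt]
        omega
      rw [hnil, List.length_nil]
      simp only [Nat.not_lt_zero, iff_false, not_exists]
      intro hi
      cases i with
      | zero => simpa using hjb
      | succ k =>
        have hk : k < L.length := by simpa using hi
        have := hbL _ (List.getElem_mem hk)
        simp only [List.getElem_cons_succ]
        omega

/-- Column lengths of the Young diagram of `μ` count the parts exceeding the column index.
[folklore] -/
private theorem colLen_youngDiagram_eq_length_filter (μ : Nat.Partition n) (j : ℕ) :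
    μ.youngDiagram.colLen j = (μ.sortedParts.filter (fun p => decide (j < p))).length := by
  have hiff : ∀ i, (i, j) ∈ μ.youngDiagram ↔
      i < (μ.sortedParts.filter (fun p => decide (j < p))).length := fun i => by
    rw [Nat.Partition.mem_youngDiagram_iff]
    exact lt_getElem_iff_lt_length_filter μ.sortedGE_sortedParts.pairwise j i
  apply le_antisymm
  · by_contra h
    push Not at h
    exact lt_irrefl _ ((hiff _).mp (YoungDiagram.mem_iff_lt_colLen.mpr h))
  · by_contra h
    push Not at h
    exact lt_irrefl _ (YoungDiagram.mem_iff_lt_colLen.mp ((hiff _).mpr h))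

/-- Zero-padded row lengths of a Young diagram. [folklore] -/
private theorem getD_rowLens_eq_rowLen (Y : YoungDiagram) (j : ℕ) : Y.rowLens.getD j 0 = Y.rowLen j := by
  by_cases hj : j < Y.rowLens.length
  · rw [List.getD_eq_getElem _ _ hj]
    exact YoungDiagram.get_rowLens
  · rw [List.getD_eq_default _ _ (not_lt.mp hj)]
    rw [YoungDiagram.length_rowLens] at hj
    symm
    by_contra h0
    have hmem : (j, 0) ∈ Y := YoungDiagram.mem_iff_lt_rowLen.mpr (Nat.pos_of_ne_zero h0)
    exact hj (YoungDiagram.mem_iff_lt_colLen.mp hmem)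

/-- **A self-associated partition in row/column form**: for `λ = λᵀ`, `λ_{j+1}` equals the number of
parts `> j` (`= λ'_{j+1}`). [cite: JamesKerber1981, 2.5.8] -/
theorem getD_sortedParts_eq_length_filter_of_transpose_eq (μ : Nat.Partition n)
    (hT : μ.transpose = μ) (j : ℕ) :
    μ.sortedParts.getD j 0 = (μ.sortedParts.filter (fun p => decide (j < p))).length := by
  conv_lhs => rw [← hT, Nat.Partition.sortedParts_transpose]
  rw [← colLen_youngDiagram_eq_length_filter, ← YoungDiagram.rowLen_transpose]
  exact getD_rowLens_eq_rowLen _ j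

/-- Filtering the peeled list: the entries `> j` of `(L_i - 1)_i` come from the entries `> j + 1`
of `L`. [folklore] -/
private theorem filter_peel (l : List ℕ) (j : ℕ) :
    ((l.map (· - 1)).filter (fun x => decide (0 < x))).filter (fun p => decide (j < p)) =
      (l.filter (fun p => decide (j + 1 < p))).map (· - 1) := by
  induction l with
  | nil => simp
  | cons b l ih =>
    simp only [List.map_cons, List.filter_cons]
    by_cases h1 : 0 < b - 1
    · rw [if_pos (by simpa using h1), List.filter_cons]
      by_cases h2 : j < b - 1
      · rw [if_pos (by simpa using h2), if_pos (by simp only [decide_eq_true_eq]; omega),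
          List.map_cons, ih]
      · rw [if_neg (by simpa using h2), if_neg (by simp only [decide_eq_true_eq]; omega), ih]
    · rw [if_neg (by simpa using h1), if_neg (by simp only [decide_eq_true_eq]; omega), ih]

/-- **`λ ∖ R₁₁` is self-associated if `λ` is**, in row/column form: the peeled list again satisfies
`L'_{j+1} = #{parts > j}`. [cite: JamesKerber1981, 2.5.8] -/
private theorem getD_peel_eq_length_filter {a : ℕ} {L : List ℕ} (hsort : (a :: L).Pairwise (· ≥ ·))
    (hinv : ∀ j, (a :: L).getD j 0 = ((a :: L).filter (fun p => decide (j < p))).length) (j : ℕ) :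
    ((L.map (· - 1)).filter (fun x => decide (0 < x))).getD j 0 =
      (L.filter (fun p => decide (j + 1 < p))).length := by
  have hL := (List.pairwise_cons.mp hsort).2
  have haL := (List.pairwise_cons.mp hsort).1
  rw [getD_peel_eq L hL]
  have h := hinv (j + 1)
  rw [List.getD_cons_succ, List.filter_cons] at h
  by_cases hja : j + 1 < a
  · rw [if_pos (by simpa using hja), List.length_cons] at h
    omega
  · rw [if_neg (by simpa using hja)] at h
    have hnil : L.filter (fun p => decide (j + 1 < p)) = [] := List.filter_eq_nil_iff.mpr fun x hx => by
      have := haL x hx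
      simp only [decide_eq_true_eq]
      omega
    rw [hnil, List.length_nil] at h ⊢
    omega

/-- **James–Kerber 2.4.8 with 2.5.12, in the form `H2`**: for every partition `μ ⊢ n` with
`μ_{j+1} = #{parts > j}` for all `j` (i.e. `μ = μᵀ`), there is `σ ∈ S_n` (of cycle type
`h(μ) = (h₁₁, h₂₂, …)`, `hᵢᵢ = 2(μᵢ - i) + 1`) with `χ^μ(σ) = ε = ±1` and `∏ (cycle lengths) ≡ ε (mod 4)`;
indeed `ε = ∏ᵢ (-1)^{(hᵢᵢ - 1)/2} = (-1)^{(n-k)/2}` and `hᵢᵢ ≡ (-1)^{(hᵢᵢ-1)/2} (mod 4)`. Proof by peeling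
the first hook `h₁₁ = 2μ₁ - 1` (leg length `μ₁ - 1`). [cite: JamesKerber1981, 2.5.12] -/
theorem exists_hookClass_of_getD_eq_length_filter : ∀ (n : ℕ) (μ : Nat.Partition n),
    (∀ j, μ.sortedParts.getD j 0 = (μ.sortedParts.filter (fun p => decide (j < p))).length) →
    ∃ (σ : Equiv.Perm (Fin n)) (e : ℤ), (e = 1 ∨ e = -1) ∧ spechtCharacter ℂ μ σ = e ∧
      (4 : ℤ) ∣ ((σ.cycleType.prod : ℕ) : ℤ) - e := by
  intro n
  induction n using Nat.strong_induction_on with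
  | _ n ih =>
  intro μ hinv
  classical
  cases hs : μ.sortedParts with
  | nil =>
    have hn : n = 0 := by
      have h := μ.sum_sortedParts; rw [hs, List.sum_nil] at h; exact h.symm
    subst hn
    refine ⟨1, 1, Or.inl rfl, ?_, by simp⟩
    rw [spechtCharacter_eq_one_of_card_parts_le_one μ
      (by rw [← μ.length_sortedParts, hs]; simp) 1, Int.cast_one]
  | cons a L =>
    have hsort : (a :: L).Pairwise (· ≥ ·) := by
      have h := μ.sortedGE_sortedParts.pairwise; rw [hs] at h; exact h
    have hpos : ∀ x ∈ a :: L, 0 < x := fun x hx => μ.pos_of_mem_sortedParts (by rw [hs]; exact hx)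
    have hinv' : ∀ j, (a :: L).getD j 0 = ((a :: L).filter (fun p => decide (j < p))).length := by
      intro j; have h := hinv j; rw [hs] at h; exact h
    -- `μ₁ = ℓ(μ)`
    have haℓ : a = L.length + 1 := by
      have h := hinv' 0
      rw [List.getD_cons_zero, List.filter_eq_self.mpr (fun x hx => by simpa using hpos x hx),
        List.length_cons] at h
      exact h
    have hsum : a + L.sum = n := by
      have h := μ.sum_sortedParts; rw [hs, List.sum_cons] at h; exact h
    by_cases ha1 : a = 1
    · -- `μ = (1)`, `n = 1`
      have hL0 : L = [] := List.eq_nil_of_length_eq_zero (by omega)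
      subst hL0
      have hn : n = 1 := by rw [List.sum_nil] at hsum; omega
      subst hn
      refine ⟨1, 1, Or.inl rfl, ?_, by simp⟩
      rw [spechtCharacter_eq_one_of_card_parts_le_one μ
        (by rw [← μ.length_sortedParts, hs]; simp) 1, Int.cast_one]
    · -- peel the first hook `h₁₁ = a + ℓ(L) = 2a - 1 ≥ 3`
      have ha2 : 2 ≤ a := by have := hpos a List.mem_cons_self; omega
      obtain ⟨hle, μ', hs'⟩ := exists_rimPeel μ hs
      have hlt : n - (a + L.length) < n := by omega
      have hinvμ' : ∀ j, μ'.sortedParts.getD j 0 =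
          (μ'.sortedParts.filter (fun p => decide (j < p))).length := by
        intro j
        rw [hs', filter_peel, List.length_map]
        exact getD_peel_eq_length_filter hsort hinv' j
      obtain ⟨σ', e', he', hχ', hdvd'⟩ := ih _ hlt μ' hinvμ'
      -- a permutation of cycle type `h₁₁ ::ₘ type(σ')`
      obtain ⟨g, hg⟩ := (Equiv.Perm.exists_with_cycleType_iff (α := Fin n)
        (m := (a + L.length) ::ₘ σ'.cycleType)).mpr ⟨by
          rw [Multiset.sum_cons, Fintype.card_fin]
          have := σ'.sum_cycleType_le; rw [Fintype.card_fin] at this; omega,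
        fun x hx => by
          rcases Multiset.mem_cons.mp hx with rfl | hx
          · omega
          · exact Equiv.Perm.two_le_of_mem_cycleType hx⟩
      have hmem : a + L.length ∈ g.cycleType := by rw [hg]; exact Multiset.mem_cons_self _ _
      obtain ⟨c, τ, rfl, hd, hc, hcard⟩ := Equiv.Perm.mem_cycleType_iff.1 hmem
      have hτ : τ.cycleType = σ'.cycleType := by
        have h1 := hd.cycleType_mul
        rw [hc.cycleType, hcard, hg, Multiset.singleton_add] at h1
        exact ((Multiset.cons_inj_right _).mp h1).symm
      have hcardB : Fintype.card ↥(c.supportᶜ) = Fintype.card (Fin (n - (a + L.length))) := by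
        rw [Fintype.card_coe, Finset.card_compl, hcard, Fintype.card_fin, Fintype.card_fin]
      set eB : ↥(c.supportᶜ) ≃ Fin (n - (a + L.length)) := Fintype.equivOfCardEq hcardB with heB
      have hval := spechtCharacter_cycle_mul_of_sortedParts_eq_cons μ hs μ' hs' hd hc hcard eB
      have hconj : spechtCharacter ℂ μ' (eB.permCongr (τ.subtypePerm
          (p := fun x => x ∈ c.supportᶜ) (fun x => mem_compl_support_iff_of_disjoint hd x))) =
          spechtCharacter ℂ μ' σ' := by
        have hct : (eB.permCongr (τ.subtypePerm (p := fun x => x ∈ c.supportᶜ)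
            (fun x => mem_compl_support_iff_of_disjoint hd x))).cycleType = σ'.cycleType := by
          rw [cycleType_permCongr, cycleType_subtypePerm_of_disjoint hd, hτ]
        obtain ⟨π, hπ⟩ := isConj_iff.mp (Equiv.Perm.isConj_iff_cycleType_eq.mpr hct.symm)
        rw [← hπ]
        exact (spechtRep ℂ μ').char_conj σ' π
      rw [hconj, hχ'] at hval
      refine ⟨c * τ, (-1) ^ L.length * e', ?_, ?_, ?_⟩
      · rcases neg_one_pow_eq_or ℤ L.length with h1 | h1 <;> rcases he' with h2 | h2 <;>
          simp [h1, h2]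
      · rw [hval]; push_cast; ring
      · rw [hg, Multiset.prod_cons]
        obtain ⟨k, hk⟩ := hdvd'
        have hk' : ((σ'.cycleType.prod : ℕ) : ℤ) = e' + 4 * k := by linarith
        rw [Nat.cast_mul, hk']
        have hsplit : ((a + L.length : ℕ) : ℤ) * (e' + 4 * k) - (-1) ^ L.length * e' =
            4 * (((a + L.length : ℕ) : ℤ) * k) + (((a + L.length : ℕ) : ℤ) * e' - (-1) ^ L.length * e') := by
          ring
        rw [hsplit]
        refine dvd_add (dvd_mul_right 4 _) ?_
        rcases Nat.even_or_odd a with ⟨b, hb⟩ | ⟨b, hb⟩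
        · have hodd : Odd L.length := ⟨b - 1, by omega⟩
          rw [hodd.neg_one_pow]
          rcases he' with rfl | rfl <;> omega
        · have heven : Even L.length := ⟨b, by omega⟩
          rw [heven.neg_one_pow]
          rcases he' with rfl | rfl <;> omega

/-- **`H2` for `λ = λᵀ`** (James–Kerber 2.4.8 with 2.5.12: `ζ^λ_{h(λ)} = (-1)^{(n-k)/2}`, and
`∏ hᵢᵢ ≡ (-1)^{(n-k)/2} (mod 4)` since `hᵢᵢ = 2(λᵢ - i) + 1`). [cite: JamesKerber1981, 2.5.12] -/
theorem exists_hookClass_of_transpose_eq (μ : Nat.Partition n) (hT : μ.transpose = μ) :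
    ∃ (σ : Equiv.Perm (Fin n)) (e : ℤ), (e = 1 ∨ e = -1) ∧ spechtCharacter ℂ μ σ = e ∧
      (4 : ℤ) ∣ ((σ.cycleType.prod : ℕ) : ℤ) - e :=
  exists_hookClass_of_getD_eq_length_filter n μ
    (getD_sortedParts_eq_length_filter_of_transpose_eq μ hT)

/-! ### The discharge -/

/-- **Discharge of the named fact `BessenrodtBehns2004_cor_3_2`** (Bessenrodt–Behns, J. Algebra 280
(2004), Cor. 3.2: for `λ = λᵀ`, `[λ]` is a constituent of `[λ]²` of multiplicity `≡ 1 (mod 4)`):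
the reduction `BessenrodtBehns2004_cor_3_2_of_hookValues` (the `A_n`-argument and Frobenius's
theorem on `{λ}₊ - {λ}₋`) fed with the principal-hook values `H1`, `H2` proved above from
Frobenius's character formula. [cite: BessenrodtBehns2004, Cor. 3.2] -/
theorem BessenrodtBehns2004_cor_3_2_holds : BessenrodtBehns2004_cor_3_2 :=
  BessenrodtBehns2004_cor_3_2_of_hookValues
    (fun _ g₀ h => exists_hookPartition_of_centralizer_le g₀ h)
    (fun _ lam hT => exists_hookClass_of_transpose_eq lam hT)

end Literature.RepresentationTheory.FiniteGroups

end
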